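import Mathlib
import Literature.Analysis.FluidPDE.Tao2016AveragedNS.RenormalisedCascadeWaves
import HarnessLib

/-!
# Travelling fronts of the UNIFORM dyadic lattice: the exact Rankine–Hugoniot relation `ψ₊ = 1/(2T)`

Helper for stmt-NavierStokesRegularity-21808 (`WakeRatchet.TailRatchet`, dead modulo the construction
`WakeRatchetDyadicFront.DyadicScalarFronts`).  The matched-asymptotics analysis of that construction (item evidence
`ASYMPTOTICS-21808-leafhand-g0.md`) reduces the scalar dyadic DSS front at small scale ratio `ε₀ → 0` to an INNER
problem: a travelling front `X_n(t) = ψ(t − nT)` of the UNIFORM (λ = 1) dyadic lattice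
`Ẋ_n = X_{n−1}² − X_n X_{n+1}` — the tree's travelling-wave ansatz `IsTW` at `(d, c₁, c₂) = (0, 1, 1)` for the
scalar structure maps `Q = 0`, `A(x) = x²`, `B(y, x) = −xy` of the dyadic member — invading the rest state
(`ψ(−∞) = 0`: the shell is empty before the front arrives) and saturating at a constant state `ψ(+∞) = ψ₊` behind it
(uniform constant states are equilibria of the uniform lattice).  This file proves the one exact relation such a
front obeys, the lattice RANKINE–HUGONIOT condition

  `ψ₊² = 2T·ψ₊³`, i.e. `ψ₊ = 0` or `ψ₊ = 1/(2T)`  (`front_level_eq`, `front_level_eq_inv_two_mul`):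

the energy `ψ²/2` has the exact derivative `P(y) − P(y − T)` with the flux potential `P(y) = ψ(y)ψ(y+T)²`
(`energy_hasDerivAt`), so over a window `[A, B]` the energy gain equals the difference of two flux integrals
over windows of length `T` (`energy_balance`), and letting `A → −∞`, `B → +∞` gives `ψ₊²/2 = T·ψ₊³`.  In the
asymptotics this is the relation `U₊ = c/2` (speed `c = 1/T` shells per unit time) that, together with the
transonic matching, pins the retention exponent of dyadic DSS fronts to the Kolmogorov value
`μ = (1+ε₀)^{−5/3+o(1)}` (so `1 − μ ≈ (5/3)ε₀`, the kit constant κ₀ ≈ 1.66 on the item).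

HONEST FRAMING: an elementary exact identity for a MODEL lattice ODE (the uniform Desnyansky–Novikov /
Katz–Pavlović chain, Tao 2016 §1.2 with λ = 1); existence of such fronts is NOT proved here (it is the open inner
half of the construction item); nothing here concerns the Navier–Stokes equations and no item is closed.
-/

noncomputable section

set_option linter.dupNamespace false

namespace Summit.NavierStokesRegularity.NavierStokesRegularity.Theorems

namespace WakeRatchetUniformFront

open Filter Topology MeasureTheory intervalIntegral Set
open scoped Interval
open Literature.Analysis.FluidPDE Literature.Analysis.FluidPDE.TaoCascade

variable {ψ : ℝ → ℝ} {T : ℝ}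

/-- The tree's travelling-wave ansatz `IsTW` at `(d, c₁, c₂) = (0, 1, 1)` for the scalar dyadic structure maps
(`Q = 0`, `A(x) = x²`, `B(y,x) = −xy`) is the profile equation `ψ' = ψ(·+T)² − ψ·ψ(·−T)` of a travelling front
`X_n(t) = ψ(t − nT)` of the uniform dyadic lattice `Ẋ_n = X_{n−1}² − X_n X_{n+1}`.
[cite: Tao2016AveragedNS, §1.2 (the dyadic model), §4 Lemma 4.1 (iii) (4.8); cell vocabulary (`IsTW`)] -/
theorem of_isTW (h : IsTW (V := ℝ) (fun _ => 0) (fun x => x ^ 2) (fun y x => -(x * y)) 0 1 1 T ψ) :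
    ∀ y : ℝ, HasDerivAt ψ (ψ (y + T) ^ 2 - ψ y * ψ (y - T)) y := by
  intro y
  have h1 := h y
  refine h1.congr_deriv ?_
  simp only [smul_eq_mul]
  ring

/-- **Energy identity.**  Along the profile equation the energy `ψ²/2` has derivative `P(y) − P(y − T)` with the
flux potential `P(y) = ψ(y) ψ(y+T)²` (what shell `n` receives from shell `n−1` minus what it passes on).
[cite: Tao2016AveragedNS, §1.2 (energy transfer `λⁿ X_{n+1} X_n²` of the dyadic model); elementary] -/
theorem energy_hasDerivAt (hψ : ∀ y, HasDerivAt ψ (ψ (y + T) ^ 2 - ψ y * ψ (y - T)) y) (y : ℝ) :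
    HasDerivAt (fun y => ψ y ^ 2 / 2)
      (ψ y * ψ (y + T) ^ 2 - ψ (y - T) * ψ ((y - T) + T) ^ 2) y := by
  have h := ((hψ y).pow 2).div_const 2
  refine h.congr_deriv ?_
  rw [sub_add_cancel]
  push_cast
  ring

/-- Continuity of the profile. [elementary] -/
theorem continuous_profile (hψ : ∀ y, HasDerivAt ψ (ψ (y + T) ^ 2 - ψ y * ψ (y - T)) y) : Continuous ψ :=
  continuous_iff_continuousAt.2 fun y => (hψ y).continuousAt

/-- **Energy balance over a window.**  `ψ(B)²/2 − ψ(A)²/2 = ∫_{B−T}^{B} P − ∫_{A−T}^{A} P`,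
`P(y) = ψ(y)ψ(y+T)²`: the energy gained on `[A, B]` is the flux through the trailing window minus the flux
through the leading window. [cite: Tao2016AveragedNS, §1.2; elementary] -/
theorem energy_balance (hψ : ∀ y, HasDerivAt ψ (ψ (y + T) ^ 2 - ψ y * ψ (y - T)) y) (A B : ℝ) :
    ψ B ^ 2 / 2 - ψ A ^ 2 / 2
      = (∫ y in (B - T)..B, ψ y * ψ (y + T) ^ 2) - ∫ y in (A - T)..A, ψ y * ψ (y + T) ^ 2 := by
  have hc := continuous_profile hψ
  set P : ℝ → ℝ := fun y => ψ y * ψ (y + T) ^ 2 with hP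
  have hPc : Continuous P := hc.mul ((hc.comp (continuous_id.add continuous_const)).pow 2)
  -- FTC for the energy
  have hderiv : ∀ y ∈ uIcc A B, HasDerivAt (fun y => ψ y ^ 2 / 2) (P y - P (y - T)) y := by
    intro y _
    simpa [hP] using energy_hasDerivAt hψ y
  have hint : IntervalIntegrable (fun y => P y - P (y - T)) volume A B :=
    ((hPc.sub (hPc.comp (continuous_id.sub continuous_const))).intervalIntegrable _ _)
  have hftc := integral_eq_sub_of_hasDerivAt hderiv hint
  -- split the integral and shift the second piece
  have h1 : ∫ y in A..B, (P y - P (y - T)) = (∫ y in A..B, P y) - ∫ y in A..B, P (y - T) :=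
    integral_sub (hPc.intervalIntegrable _ _) ((hPc.comp (continuous_id.sub continuous_const)).intervalIntegrable _ _)
  have h2 : ∫ y in A..B, P (y - T) = ∫ y in (A - T)..(B - T), P y := by
    exact intervalIntegral.integral_comp_sub_right (fun y => P y) T
  have h3 : (∫ y in A..B, P y) - ∫ y in (A - T)..(B - T), P y
      = (∫ y in (B - T)..B, P y) - ∫ y in (A - T)..A, P y := by
    have e1 : ∫ y in (A - T)..B, P y = (∫ y in (A - T)..A, P y) + ∫ y in A..B, P y :=
      (integral_add_adjacent_intervals (hPc.intervalIntegrable _ _) (hPc.intervalIntegrable _ _)).symm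
    have e2 : ∫ y in (A - T)..B, P y = (∫ y in (A - T)..(B - T), P y) + ∫ y in (B - T)..B, P y :=
      (integral_add_adjacent_intervals (hPc.intervalIntegrable _ _) (hPc.intervalIntegrable _ _)).symm
    linarith
  rw [← hftc, h1, h2, h3]

/-- Window integrals of a continuous function with a limit at `+∞`: `∫_{B−T}^{B} f → T·c` as `B → +∞`.
[folklore] -/
theorem tendsto_window_integral_atTop {f : ℝ → ℝ} {c : ℝ} (hf : Continuous f) (hT : 0 ≤ T)
    (h : Tendsto f atTop (𝓝 c)) :
    Tendsto (fun B => ∫ y in (B - T)..B, f y) atTop (𝓝 (T * c)) := by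
  rw [Metric.tendsto_atTop]
  intro ε hε
  have hε' : 0 < ε / (T + 1) := div_pos hε (by linarith)
  obtain ⟨N, hN⟩ := (Metric.tendsto_atTop.1 h) (ε / (T + 1)) hε'
  refine ⟨N + T, fun B hB => ?_⟩
  have hconst : ∫ _ in (B - T)..B, c = T * c := by
    rw [intervalIntegral.integral_const, smul_eq_mul]; ring
  have hsub : (∫ y in (B - T)..B, f y) - T * c = ∫ y in (B - T)..B, (f y - c) := by
    rw [intervalIntegral.integral_sub (hf.intervalIntegrable _ _) (continuous_const.intervalIntegrable _ _),
      hconst]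
  rw [Real.dist_eq, hsub]
  have hbound : ∀ y ∈ Ι (B - T) B, ‖f y - c‖ ≤ ε / (T + 1) := by
    intro y hy
    rw [uIoc_of_le (by linarith)] at hy
    have hyN : N ≤ y := by linarith [hy.1]
    exact (le_of_lt (by simpa [Real.dist_eq] using hN y hyN))
  have key := intervalIntegral.norm_integral_le_of_norm_le_const hbound
  rw [Real.norm_eq_abs] at key
  calc |∫ y in (B - T)..B, (f y - c)| ≤ ε / (T + 1) * |B - (B - T)| := key
    _ = ε / (T + 1) * T := by rw [show B - (B - T) = T by ring, abs_of_nonneg hT]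
    _ < ε := by
        rw [div_mul_eq_mul_div, div_lt_iff₀ (by linarith)]
        nlinarith

/-- Window integrals of a function with limit `0` at `−∞`: `∫_{A−T}^{A} f → 0` as `A → −∞` (no
integrability needed: the interval-integral bound by the sup holds for the junk value too). [folklore] -/
theorem tendsto_window_integral_atBot {f : ℝ → ℝ} (hT : 0 ≤ T)
    (h : Tendsto f atBot (𝓝 0)) :
    Tendsto (fun A => ∫ y in (A - T)..A, f y) atBot (𝓝 0) := by
  refine Metric.tendsto_nhds.2 fun ε hε => ?_
  have hε' : 0 < ε / (T + 1) := div_pos hε (by linarith)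
  obtain ⟨N, hN⟩ := Filter.eventually_atBot.1 (Metric.tendsto_nhds.1 h (ε / (T + 1)) hε')
  refine Filter.eventually_atBot.2 ⟨N, fun A hA => ?_⟩
  rw [Real.dist_eq, sub_zero]
  have hbound : ∀ y ∈ Ι (A - T) A, ‖f y‖ ≤ ε / (T + 1) := by
    intro y hy
    rw [uIoc_of_le (by linarith)] at hy
    have hyN : y ≤ N := by linarith [hy.2]
    have := hN y hyN
    rw [Real.dist_eq, sub_zero] at this
    exact this.le
  have key := intervalIntegral.norm_integral_le_of_norm_le_const hbound
  rw [Real.norm_eq_abs] at key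
  calc |∫ y in (A - T)..A, f y| ≤ ε / (T + 1) * |A - (A - T)| := key
    _ = ε / (T + 1) * T := by rw [show A - (A - T) = T by ring, abs_of_nonneg hT]
    _ < ε := by
        rw [div_mul_eq_mul_div, div_lt_iff₀ (by linarith)]
        nlinarith

/-- **Lattice Rankine–Hugoniot relation.**  A travelling front of the uniform dyadic lattice — a global `C¹`
profile `ψ' = ψ(·+T)² − ψ·ψ(·−T)`, `T ≥ 0`, with `ψ → 0` at `−∞` (empty shell ahead of the front) and `ψ → ψ₊`
at `+∞` (saturated shell behind it) — satisfies `ψ₊² = 2T·ψ₊³`: the energy deposited per shell, `ψ₊²/2`, equals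
the flux `T·ψ₊³` carried through a saturated window.
[cite: Tao2016AveragedNS, §1.2 (dyadic model, energy transfer); elementary] -/
theorem front_level_eq (hT : 0 ≤ T) (hψ : ∀ y, HasDerivAt ψ (ψ (y + T) ^ 2 - ψ y * ψ (y - T)) y) {ψp : ℝ}
    (hbot : Tendsto ψ atBot (𝓝 0)) (htop : Tendsto ψ atTop (𝓝 ψp)) : ψp ^ 2 = 2 * T * ψp ^ 3 := by
  have hc := continuous_profile hψ
  have hPc : Continuous (fun y => ψ y * ψ (y + T) ^ 2) :=
    hc.mul ((hc.comp (continuous_id.add continuous_const)).pow 2)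
  -- limits of the flux potential
  have hPtop : Tendsto (fun y => ψ y * ψ (y + T) ^ 2) atTop (𝓝 (ψp * ψp ^ 2)) :=
    htop.mul ((htop.comp (tendsto_atTop_add_const_right _ _ tendsto_id)).pow 2)
  have hPbot : Tendsto (fun y => ψ y * ψ (y + T) ^ 2) atBot (𝓝 0) := by
    have h1 : Tendsto (fun y => ψ (y + T)) atBot (𝓝 0) :=
      hbot.comp (tendsto_atBot_add_const_right _ _ tendsto_id)
    have h2 : Tendsto (fun y => ψ y * ψ (y + T) ^ 2) atBot (𝓝 (0 * 0 ^ 2)) := hbot.mul (h1.pow 2)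
    norm_num at h2
    exact h2
  -- step 1: for every `B`, `ψ(B)²/2 − ∫_{B−T}^{B} P = 0` (let `A → −∞` in the energy balance)
  have hB : ∀ B : ℝ, ψ B ^ 2 / 2 - ∫ y in (B - T)..B, ψ y * ψ (y + T) ^ 2 = 0 := by
    intro B
    have e : ∀ A : ℝ, ψ A ^ 2 / 2 - (∫ y in (A - T)..A, ψ y * ψ (y + T) ^ 2)
        = ψ B ^ 2 / 2 - ∫ y in (B - T)..B, ψ y * ψ (y + T) ^ 2 := by
      intro A
      linarith [energy_balance hψ A B]
    have hA : Tendsto (fun A : ℝ => ψ A ^ 2 / 2 - ∫ y in (A - T)..A, ψ y * ψ (y + T) ^ 2) atBot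
        (𝓝 (0 ^ 2 / 2 - 0)) :=
      ((hbot.pow 2).div_const 2).sub (tendsto_window_integral_atBot hT hPbot)
    have hA' : Tendsto (fun _ : ℝ => ψ B ^ 2 / 2 - ∫ y in (B - T)..B, ψ y * ψ (y + T) ^ 2) atBot
        (𝓝 (0 ^ 2 / 2 - 0)) := hA.congr e
    have h3 := tendsto_nhds_unique tendsto_const_nhds hA'
    norm_num at h3
    linarith
  -- step 2: let `B → +∞`
  have hlim : Tendsto (fun B : ℝ => ψ B ^ 2 / 2 - ∫ y in (B - T)..B, ψ y * ψ (y + T) ^ 2) atTop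
      (𝓝 (ψp ^ 2 / 2 - T * (ψp * ψp ^ 2))) :=
    ((htop.pow 2).div_const 2).sub (tendsto_window_integral_atTop hPc hT hPtop)
  have hzero : Tendsto (fun B : ℝ => ψ B ^ 2 / 2 - ∫ y in (B - T)..B, ψ y * ψ (y + T) ^ 2) atTop
      (𝓝 0) := by
    simp_rw [hB]; exact tendsto_const_nhds
  have heq := tendsto_nhds_unique hlim hzero
  nlinarith [heq]

/-- **The saturation level of a non-trivial front is `1/(2T)`** (equivalently, with speed `c = 1/T` shells per
unit time, `ψ₊ = c/2`). [cite: Tao2016AveragedNS, §1.2; elementary] -/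
theorem front_level_eq_inv_two_mul (hT : 0 ≤ T) (hψ : ∀ y, HasDerivAt ψ (ψ (y + T) ^ 2 - ψ y * ψ (y - T)) y)
    {ψp : ℝ} (hbot : Tendsto ψ atBot (𝓝 0)) (htop : Tendsto ψ atTop (𝓝 ψp)) (hne : ψp ≠ 0) :
    0 < T ∧ ψp = 1 / (2 * T) := by
  have h := front_level_eq hT hψ hbot htop
  have h2 : ψp ^ 2 * (1 - 2 * T * ψp) = 0 := by nlinarith [h]
  have h3 : 1 - 2 * T * ψp = 0 := by
    rcases mul_eq_zero.1 h2 with h4 | h4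
    · exact absurd (pow_eq_zero_iff (n := 2) (by norm_num) |>.1 h4) hne
    · exact h4
  have hT0 : 0 < T := by
    rcases hT.eq_or_lt with h5 | h5
    · rw [← h5] at h3; norm_num at h3
    · exact h5
  refine ⟨hT0, ?_⟩
  field_simp
  linarith

/-- The same relation for a profile in the tree's `IsTW` vocabulary (uniform lattice, `(d, c₁, c₂) = (0, 1, 1)`,
scalar dyadic structure maps). [cite: Tao2016AveragedNS, §1.2, §4 (4.8); cell vocabulary (`IsTW`)] -/
theorem front_level_of_isTW (hT : 0 ≤ T)
    (h : IsTW (V := ℝ) (fun _ => 0) (fun x => x ^ 2) (fun y x => -(x * y)) 0 1 1 T ψ) {ψp : ℝ}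
    (hbot : Tendsto ψ atBot (𝓝 0)) (htop : Tendsto ψ atTop (𝓝 ψp)) (hne : ψp ≠ 0) :
    ψp = 1 / (2 * T) :=
  (front_level_eq_inv_two_mul hT (of_isTW h) hbot htop hne).2

end WakeRatchetUniformFront

end Summit.NavierStokesRegularity.NavierStokesRegularity.Theorems

end
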